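import Literature.AlgebraicTopology.SingularHomology.TorusHomologyPontryaginBasis
import Literature.AlgebraicTopology.SingularHomology.KroneckerCrossProductNormalized
import HarnessLib

/-!
# The Pontryagin product of monomials is concatenation: `λ_I ⋆ λ_J = λ_{IJ}`; associativity of `⋆` on
# `H_{≥1}((ℝ/ℤ)ⁿ; ℤ)` and vanishing of monomials with a repeated circle

Topic `Literature/AlgebraicTopology/SingularHomology`; sequel of `TorusHomologyPontryaginBasis.lean`
(Pontryagin monomials `λ_{e 0} ⋆ ⋯ ⋆ λ_{e k}` of the real torus `Tⁿ = (ℝ/ℤ)ⁿ`, their `ℤ`-basis of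
`Hₖ₊₁(Tⁿ; ℤ)`, the duality `⟨ξ_t, λ_s⟩ = δ`) and of `KroneckerCrossProductNormalized.lean`
(`⟨pr₁^*α ⌣ pr₂^*β, x × y⟩ = ⟨α, x⟩ ⟨β, y⟩` for classes with normalised representatives).

Lange 2023, Exercise 1.1.6 (11) (held p0028): for a real Lie group `G` the Pontryagin product
satisfies "(ii) `([σ] ⋆ [τ]) ⋆ [λ] = [σ] ⋆ ([τ] ⋆ [λ])`", and the monomials of §2.5.3 are written
`λ_I = λ_{i₁} ⋆ ⋯ ⋆ λ_{i_p}` without brackets (p0133 L15–L17). On SINGULAR homology, with `⋆ = μ_* ∘ ×`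
defined through the Eilenberg–Zilber shuffle product, associativity is a theorem; we prove it for the
torus WITHOUT the chain-level associativity of the shuffle product, through push-forwards:

* `torusWordHom w : Tᵈ → Tⁿ`, `x ↦ ∑ᵢ axis_{w i}(xᵢ)` — the continuous homomorphism of a word
  `w : Fin d → Fin n`; `λ_w = (torusWordHom w)_* (λ₀ ⋆ ⋯ ⋆ λ_d)` (`pontryaginMonomial_eq_map_torusWordHom`);
* `torusConcat : Tᵏ⁺¹ × Tˡ⁺¹ → Tᵏ⁺ˡ⁺²` (concatenation of coordinates) carries the cross product of the
  top monomials to the top monomial: `(λ₀ ⋆ ⋯ ⋆ λₖ) × (λ₀ ⋆ ⋯ ⋆ λₗ) ↦ λ₀ ⋆ ⋯ ⋆ λₖ₊ₗ₊₁`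
  (`map_torusConcat_cross_topMonomial`) — checked on the one-dimensional `Hₖ₊ₗ₊₂(Tᵏ⁺ˡ⁺²; ℤ)` by pairing
  with the top cup monomial, which splits as `pr₁^*(ξ₀ ⌣ ⋯ ⌣ ξₖ) ⌣ pr₂^*(ξ₀ ⌣ ⋯ ⌣ ξₗ)` (`cupMonomial_add`,
  cup monomials have normalised representatives `hasNormalizedRep_cupMonomial`);
* **`addPontryagin_pontryaginMonomial`: `λ_I ⋆ λ_J = λ_{IJ}`** (concatenated word) — since
  `μ ∘ (φ_I × φ_J) = φ_{IJ} ∘ torusConcat`;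
* **`addPontryagin_assoc`: `(x ⋆ y) ⋆ z = x ⋆ (y ⋆ z)`** on `H_{≥1}(Tⁿ; ℤ)` (trilinear, checked on the
  monomial bases) — Exercise 1.1.6 (11)(b)(ii) for the torus;
* **`pontryaginMonomial_eq_zero_of_not_injective`: `λ_w = 0` if `w` repeats a letter** — `φ_w` factors
  through a torus of smaller dimension, whose homology vanishes in degree `d` (rank `C(d-1, d) = 0`);
  in particular `λ_a ⋆ λ_a = 0`.

Everything is proved; definitions with bodies (`torusWordHom`, `torusWordAddHom`, `appendWord`,
`torusConcat`); no named fact.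

## References

* [Lange2023AbelianVarietiesComplex] H. Lange, *Abelian Varieties over the Complex Numbers* (2023),
  §1.1 Exercise 1.1.6 (11), (12) (p. 28); §2.5.3 pp. 132–134 (Lemma 2.5.11, Lemma 2.5.12, Prop. 2.5.13).
* [HatcherAT2002] A. Hatcher, *Algebraic Topology* (2002), §3.B pp. 277–280, §3.C p. 287, §3.2 Example 3.16.
-/

noncomputable section

open CategoryTheory Module

universe u v

namespace Literature.AlgebraicTopology.SingularHomology

open singularHomology

/-! ### The homomorphism of a word and monomials as push-forwards of top monomials -/

section WordHom

variable {d m n : ℕ}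

/-- **The continuous homomorphism `Tᵈ → Tⁿ` of a word** `w : Fin d → Fin n`:
`x ↦ ∑ᵢ axis_{w i}(xᵢ)`, i.e. `(φ_w x)_a = ∑_{w i = a} xᵢ` (the homomorphism `ℝᵈ/ℤᵈ → ℝⁿ/ℤⁿ` of the
integer matrix of `w`; for an increasing `w` the sub-torus `subtorus`). [cite: Lange2023AbelianVarietiesComplex, Exercise 1.1.6 (11)–(12) (held p0028)] -/
def torusWordHom (w : Fin d → Fin n) : C(Torus d, Torus n) where
  toFun x := ∑ i, torusAxis n (w i) (x i)
  continuous_toFun := continuous_finsetSum _ fun i _ ↦ (torusAxis n (w i)).continuous.comp (continuous_apply i)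

/-- Values of the word homomorphism. [cite: Lange2023AbelianVarietiesComplex, Exercise 1.1.6 (11)–(12) (held p0028)] -/
theorem torusWordHom_apply (w : Fin d → Fin n) (x : Torus d) :
    torusWordHom w x = ∑ i, (Pi.single (w i) (x i) : Torus n) := rfl

/-- The word homomorphism is additive. [cite: Lange2023AbelianVarietiesComplex, Exercise 1.1.6 (11)–(12) (held p0028)] -/
theorem torusWordHom_add (w : Fin d → Fin n) (a b : Torus d) :
    torusWordHom w (a + b) = torusWordHom w a + torusWordHom w b := by
  simp only [torusWordHom_apply, Pi.add_apply, Pi.single_add, Finset.sum_add_distrib]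

/-- The word homomorphism as a homomorphism of additive groups. [cite: Lange2023AbelianVarietiesComplex, Exercise 1.1.6 (11)–(12) (held p0028)] -/
def torusWordAddHom (w : Fin d → Fin n) : Torus d →+ Torus n where
  toFun := torusWordHom w
  map_zero' := by simp [torusWordHom_apply]
  map_add' := torusWordHom_add w

/-- The additive-group homomorphism is the word homomorphism. [cite: Lange2023AbelianVarietiesComplex, Exercise 1.1.6 (11)–(12) (held p0028)] -/
@[simp]
theorem torusWordAddHom_apply (w : Fin d → Fin n) (x : Torus d) : torusWordAddHom w x = torusWordHom w x := rfl

/-- The word homomorphism carries the `i`-th axis to the `w i`-th axis. [cite: Lange2023AbelianVarietiesComplex, Exercise 1.1.6 (12) (held p0028 L29)] -/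
theorem torusWordHom_comp_torusAxis (w : Fin d → Fin n) (i : Fin d) :
    (torusWordHom w).comp (torusAxis d i) = torusAxis n (w i) := by
  ext t : 1
  rw [ContinuousMap.comp_apply, torusAxis_apply, torusWordHom_apply, torusAxis_apply,
    Finset.sum_eq_single i (fun j _ hj ↦ by rw [Pi.single_eq_of_ne hj, Pi.single_zero])
      (fun h ↦ absurd (Finset.mem_univ i) h), Pi.single_eq_same]

/-- Word homomorphisms compose: `φ_v ∘ φ_w = φ_{v ∘ w}`. [cite: Lange2023AbelianVarietiesComplex, Exercise 1.1.6 (11)–(12) (held p0028)] -/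
theorem torusWordHom_comp (v : Fin m → Fin n) (w : Fin d → Fin m) :
    (torusWordHom v).comp (torusWordHom w) = torusWordHom (v ∘ w) := by
  ext x : 1
  rw [ContinuousMap.comp_apply, torusWordHom_apply w, ← torusWordAddHom_apply, map_sum, torusWordHom_apply]
  refine Finset.sum_congr rfl fun i _ ↦ ?_
  rw [torusWordAddHom_apply, ← torusAxis_apply (n := m), ← ContinuousMap.comp_apply, torusWordHom_comp_torusAxis,
    torusAxis_apply, Function.comp_apply]

variable {k l : ℕ}

/-- **Monomials are push-forwards of top monomials**: `λ_{e 0} ⋆ ⋯ ⋆ λ_{e k} = (φ_e)_* (λ₀ ⋆ ⋯ ⋆ λₖ)`.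
[cite: Lange2023AbelianVarietiesComplex, Exercise 1.1.6 (11)–(12) (held p0028)] -/
theorem pontryaginMonomial_eq_map_torusWordHom (e : Fin (k + 1) → Fin n) :
    pontryaginMonomial n k e = singularHomology.map ℤ ℤ (torusWordHom e) (k + 1) (topMonomial k) := by
  rw [topMonomial, map_pontryaginMonomial (torusWordHom e) (torusWordHom_add e) e (torusWordHom_comp_torusAxis e)]
  rfl

end WordHom

/-! ### Cup monomials: splitting and normalised representatives -/

section CupMonomials

variable {R : Type v} [CommRing R] {Y : Type u} [TopologicalSpace Y] {n : ℕ}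

/-- **Splitting a cup monomial**: `x_{w 0} ⌣ ⋯ ⌣ x_{w (a+b-1)} = (x_{w 0} ⌣ ⋯ ⌣ x_{w (a-1)}) ⌣ (x_{w a} ⌣ ⋯)`
(associativity of the cup product, Hatcher 2002, §3.2 p. 211). [cite: HatcherAT2002, §3.2 Example 3.16] -/
theorem cupMonomial_add (x : Fin n → singularCohomology R R Y 1) (a : ℕ) :
    ∀ (b : ℕ) (w : Fin (a + b) → Fin n),
      cupMonomial x (a + b) w =
        cupProduct rfl (cupMonomial x a (w ∘ Fin.castAdd b)) (cupMonomial x b (w ∘ Fin.natAdd a))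
  | 0, w => by
    rw [cupMonomial_zero]
    exact (cupProduct_one _).symm
  | b + 1, w => by
    change cupMonomial x (a + b + 1) w = _
    rw [cupMonomial_succ, cupMonomial_succ, cupMonomial_add x a b (w ∘ Fin.castSucc),
      cupProduct_assoc rfl rfl rfl rfl]
    rfl

/-- Splitting a cup monomial along any decomposition `a + b = c` of its length.
[cite: HatcherAT2002, §3.2 Example 3.16] -/
theorem cupMonomial_split (x : Fin n → singularCohomology R R Y 1) {a b c : ℕ} (h : a + b = c) (w : Fin c → Fin n) :
    cupMonomial x c w =
      cupProduct h (cupMonomial x a fun i ↦ w (Fin.cast h (Fin.castAdd b i)))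
        (cupMonomial x b fun j ↦ w (Fin.cast h (Fin.natAdd a j))) := by
  subst h
  exact cupMonomial_add x a b w

/-- The unit class has a normalised representative (degree `0`: no degenerate `0`-simplices).
[cite: HatcherAT2002, §3.2 p. 211] -/
theorem hasNormalizedRep_one : HasNormalizedRep (singularCohomology.one R Y) :=
  ⟨_, rfl, fun _ _ _ _ _ hinj ↦ absurd (fun i j _ ↦ Subsingleton.elim (α := Fin 1) i j) hinj⟩

/-- **Cup monomials of classes with normalised representatives have normalised representatives.**
[cite: HatcherAT2002, §3.2 p. 206] -/
theorem hasNormalizedRep_cupMonomial {x : Fin n → singularCohomology R R Y 1} (hx : ∀ i, HasNormalizedRep (x i)) :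
    ∀ (k : ℕ) (e : Fin k → Fin n), HasNormalizedRep (cupMonomial x k e)
  | 0, _ => hasNormalizedRep_one
  | k + 1, e => (hasNormalizedRep_cupMonomial hx k (e ∘ Fin.castSucc)).cupProduct rfl (hx (e (Fin.last k)))

/-- The cup monomials `ξ_{e 0} ⌣ ⋯` of the torus have normalised representatives.
[cite: HatcherAT2002, §3.2 Example 3.16] -/
theorem hasNormalizedRep_torusMonomial (n k : ℕ) (e : Fin k → Fin n) : HasNormalizedRep (torusMonomial R n k e) :=
  hasNormalizedRep_cupMonomial (fun i ↦ hasNormalizedRep_of_one (torusXi R n i)) k e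

/-- The top cup monomial `ξ₀ ⌣ ⋯ ⌣ ξₖ₋₁` of `Tᵏ` has a normalised representative. [cite: HatcherAT2002, §3.2 Example 3.16] -/
theorem hasNormalizedRep_torusTop (k : ℕ) : HasNormalizedRep (torusTop R k) :=
  hasNormalizedRep_torusMonomial k k id

/-- The word of the full subset of `Fin d` is the identity (the top multi-index `(1 < ⋯ < d)`). [cite: Lange2023AbelianVarietiesComplex, §2.5.3 (held p0133 L15–L17)] -/
theorem subsetEmb_eq_id {d : ℕ} (t : Set.powersetCard (Fin d) d) : (subsetEmb t : Fin d → Fin d) = id :=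
  ((subsetEmb t).strictMono.range_inj strictMono_id).mp (by
    rw [Set.range_id, Set.range_eq_univ]
    exact Finite.surjective_of_injective (subsetEmb t).injective)

end CupMonomials

/-! ### Concatenation of words and of coordinates -/

section Concat

variable {n k l m : ℕ}

/-- **Concatenation of words** `e : Fin (k+1) → Fin n`, `e' : Fin (l+1) → Fin n` to a word of length
`m + 1 = (k+1) + (l+1)`. [cite: Lange2023AbelianVarietiesComplex, §2.5.3 (held p0133 L15–L17)] -/
def appendWord (e : Fin (k + 1) → Fin n) (e' : Fin (l + 1) → Fin n) (m : ℕ) (h : k + 1 + (l + 1) = m + 1)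
    (i : Fin (m + 1)) : Fin n :=
  if hi : (i : ℕ) < k + 1 then e ⟨i, hi⟩ else e' ⟨i - (k + 1), by omega⟩

/-- The first letters of a concatenated word. [cite: Lange2023AbelianVarietiesComplex, §2.5.3 (held p0133 L15–L17)] -/
theorem appendWord_apply_of_lt (e : Fin (k + 1) → Fin n) (e' : Fin (l + 1) → Fin n) (h : k + 1 + (l + 1) = m + 1)
    (i : Fin (m + 1)) (hi : (i : ℕ) < k + 1) : appendWord e e' m h i = e ⟨i, hi⟩ := dif_pos hi

/-- The last letters of a concatenated word. [cite: Lange2023AbelianVarietiesComplex, §2.5.3 (held p0133 L15–L17)] -/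
theorem appendWord_apply_of_le (e : Fin (k + 1) → Fin n) (e' : Fin (l + 1) → Fin n) (h : k + 1 + (l + 1) = m + 1)
    (i : Fin (m + 1)) (hi : k + 1 ≤ (i : ℕ)) :
    appendWord e e' m h i = e' ⟨i - (k + 1), by omega⟩ := dif_neg (Nat.not_lt.mpr hi)

variable (k l) in
/-- **Concatenation of coordinates** `Tᵏ⁺¹ × Tˡ⁺¹ → Tᵐ⁺¹`, `((x₀,…,xₖ),(y₀,…,yₗ)) ↦ (x₀,…,xₖ,y₀,…,yₗ)`
(`m + 1 = (k+1) + (l+1)`). [cite: Lange2023AbelianVarietiesComplex, §2.5.3 Lemma 2.5.12 (proof, held p0133)] -/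
def torusConcat (m : ℕ) (h : k + 1 + (l + 1) = m + 1) : C(Torus (k + 1) × Torus (l + 1), Torus (m + 1)) where
  toFun z i := if hi : (i : ℕ) < k + 1 then z.1 ⟨i, hi⟩ else z.2 ⟨i - (k + 1), by omega⟩
  continuous_toFun := by
    refine continuous_pi fun i ↦ ?_
    by_cases hi : (i : ℕ) < k + 1
    · simp only [dif_pos hi]; exact (continuous_apply _).comp continuous_fst
    · simp only [dif_neg hi]; exact (continuous_apply _).comp continuous_snd

/-- The first coordinates of a concatenation. [cite: Lange2023AbelianVarietiesComplex, §2.5.3 Lemma 2.5.12 (proof, held p0133)] -/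
theorem torusConcat_apply_of_lt (h : k + 1 + (l + 1) = m + 1) (z : Torus (k + 1) × Torus (l + 1)) (i : Fin (m + 1))
    (hi : (i : ℕ) < k + 1) : torusConcat k l m h z i = z.1 ⟨i, hi⟩ := dif_pos hi

/-- The last coordinates of a concatenation. [cite: Lange2023AbelianVarietiesComplex, §2.5.3 Lemma 2.5.12 (proof, held p0133)] -/
theorem torusConcat_apply_of_le (h : k + 1 + (l + 1) = m + 1) (z : Torus (k + 1) × Torus (l + 1)) (i : Fin (m + 1))
    (hi : k + 1 ≤ (i : ℕ)) : torusConcat k l m h z i = z.2 ⟨i - (k + 1), by omega⟩ := dif_neg (Nat.not_lt.mpr hi)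

/-- **`μ ∘ (φ_e × φ_{e'}) = φ_{e e'} ∘ concat`**: adding the images of the two word homomorphisms is the
word homomorphism of the concatenated word after concatenating coordinates.
[cite: Lange2023AbelianVarietiesComplex, §2.5.3 Lemma 2.5.12 (proof: `p₁ + p₂ = μ`, held p0133)] -/
theorem addMap_comp_prodMap_torusWordHom (e : Fin (k + 1) → Fin n) (e' : Fin (l + 1) → Fin n)
    (h : k + 1 + (l + 1) = m + 1) :
    (addMap (Torus n)).comp ((torusWordHom e).prodMap (torusWordHom e')) =
      (torusWordHom (appendWord e e' m h)).comp (torusConcat k l m h) := by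
  have hsum : ∀ F : Fin (m + 1) → Torus n, ∑ i, F i =
      ∑ i : Fin (k + 1), F (Fin.cast h (Fin.castAdd (l + 1) i)) + ∑ j : Fin (l + 1), F (Fin.cast h (Fin.natAdd (k + 1) j)) :=
    fun F ↦ by rw [← Equiv.sum_comp (finCongr h) F, Fin.sum_univ_add]; rfl
  ext ⟨x, y⟩ : 1
  simp only [ContinuousMap.comp_apply, ContinuousMap.prodMap_apply, Prod.map_fst, Prod.map_snd, addMap_apply]
  rw [torusWordHom_apply, torusWordHom_apply, torusWordHom_apply, hsum]
  congr 1
  · refine Finset.sum_congr rfl fun i _ ↦ ?_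
    have hi : ((Fin.cast h (Fin.castAdd (l + 1) i) : Fin (m + 1)) : ℕ) < k + 1 := i.2
    have hi' : (⟨((Fin.cast h (Fin.castAdd (l + 1) i) : Fin (m + 1)) : ℕ), hi⟩ : Fin (k + 1)) = i := Fin.ext rfl
    rw [appendWord_apply_of_lt e e' h _ hi, torusConcat_apply_of_lt h _ _ hi, hi']
  · refine Finset.sum_congr rfl fun j _ ↦ ?_
    have hj : k + 1 ≤ ((Fin.cast h (Fin.natAdd (k + 1) j) : Fin (m + 1)) : ℕ) := Nat.le_add_right _ _
    have hj' : (⟨((Fin.cast h (Fin.natAdd (k + 1) j) : Fin (m + 1)) : ℕ) - (k + 1), by omega⟩ : Fin (l + 1)) = j :=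
      Fin.ext (Nat.add_sub_cancel_left _ _)
    rw [appendWord_apply_of_le e e' h _ hj, torusConcat_apply_of_le h _ _ hj, hj']

/-- The first coordinates of a concatenation: `p_i ∘ concat = p_i ∘ pr₁` (`i ≤ k`).
[cite: Lange2023AbelianVarietiesComplex, §2.5.3 Lemma 2.5.12 (proof, held p0133)] -/
theorem torusProj_comp_torusConcat_of_lt (h : k + 1 + (l + 1) = m + 1) (i : Fin (m + 1)) (hi : (i : ℕ) < k + 1) :
    (torusProj (m + 1) i).comp (torusConcat k l m h) = (torusProj (k + 1) ⟨i, hi⟩).comp ContinuousMap.fst := by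
  ext z : 1
  rw [ContinuousMap.comp_apply, ContinuousMap.comp_apply, torusProj_apply, torusProj_apply, torusConcat_apply_of_lt h z i hi]
  rfl

/-- The last coordinates of a concatenation: `p_{k+1+j} ∘ concat = p_j ∘ pr₂`.
[cite: Lange2023AbelianVarietiesComplex, §2.5.3 Lemma 2.5.12 (proof, held p0133)] -/
theorem torusProj_comp_torusConcat_of_le (h : k + 1 + (l + 1) = m + 1) (i : Fin (m + 1)) (hi : k + 1 ≤ (i : ℕ)) :
    (torusProj (m + 1) i).comp (torusConcat k l m h) =
      (torusProj (l + 1) ⟨i - (k + 1), by omega⟩).comp ContinuousMap.snd := by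
  ext z : 1
  rw [ContinuousMap.comp_apply, ContinuousMap.comp_apply, torusProj_apply, torusProj_apply, torusConcat_apply_of_le h z i hi]
  rfl

/-- Pull-back of the first coordinate classes along the concatenation: `concat^* ξ_i = pr₁^* ξ_i`.
[cite: HatcherAT2002, §3.2 Example 3.16] -/
theorem map_torusConcat_torusXi_of_lt (h : k + 1 + (l + 1) = m + 1) (i : Fin (m + 1)) (hi : (i : ℕ) < k + 1) :
    singularCohomology.map ℤ ℤ (torusConcat k l m h) 1 (torusXi ℤ (m + 1) i) =
      singularCohomology.map ℤ ℤ (ContinuousMap.fst : C(Torus (k + 1) × Torus (l + 1), Torus (k + 1))) 1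
        (torusXi ℤ (k + 1) ⟨i, hi⟩) := by
  rw [torusXi, torusXi, ← ModuleCat.comp_apply, ← singularCohomology.map_comp, torusProj_comp_torusConcat_of_lt h i hi,
    singularCohomology.map_comp, ModuleCat.comp_apply]

/-- Pull-back of the last coordinate classes along the concatenation: `concat^* ξ_{k+1+j} = pr₂^* ξ_j`.
[cite: HatcherAT2002, §3.2 Example 3.16] -/
theorem map_torusConcat_torusXi_of_le (h : k + 1 + (l + 1) = m + 1) (i : Fin (m + 1)) (hi : k + 1 ≤ (i : ℕ)) :
    singularCohomology.map ℤ ℤ (torusConcat k l m h) 1 (torusXi ℤ (m + 1) i) =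
      singularCohomology.map ℤ ℤ (ContinuousMap.snd : C(Torus (k + 1) × Torus (l + 1), Torus (l + 1))) 1
        (torusXi ℤ (l + 1) ⟨i - (k + 1), by omega⟩) := by
  rw [torusXi, torusXi, ← ModuleCat.comp_apply, ← singularCohomology.map_comp, torusProj_comp_torusConcat_of_le h i hi,
    singularCohomology.map_comp, ModuleCat.comp_apply]

/-- **The top cup monomial splits along the concatenation**:
`concat^* (ξ₀ ⌣ ⋯ ⌣ ξₘ) = pr₁^*(ξ₀ ⌣ ⋯ ⌣ ξₖ) ⌣ pr₂^*(ξ₀ ⌣ ⋯ ⌣ ξₗ)`.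
[cite: Lange2023AbelianVarietiesComplex, §2.5.3 Lemma 2.5.12 (proof: `μ^* dx_J = ∧ (p₁^* dx + p₂^* dx)`, held p0133)] -/
theorem map_torusConcat_torusTop (h : k + 1 + (l + 1) = m + 1) :
    singularCohomology.map ℤ ℤ (torusConcat k l m h) (m + 1) (torusTop ℤ (m + 1)) =
      cupProduct h
        (singularCohomology.map ℤ ℤ (ContinuousMap.fst : C(Torus (k + 1) × Torus (l + 1), Torus (k + 1)))
          (k + 1) (torusTop ℤ (k + 1)))
        (singularCohomology.map ℤ ℤ (ContinuousMap.snd : C(Torus (k + 1) × Torus (l + 1), Torus (l + 1)))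
          (l + 1) (torusTop ℤ (l + 1))) := by
  rw [torusTop, torusMonomial, cupMonomial_split (torusXi ℤ (m + 1)) h id, cupProduct_map, map_cupMonomial,
    map_cupMonomial, torusTop, torusTop, torusMonomial, torusMonomial, map_cupMonomial, map_cupMonomial]
  have h₁ : ((fun i ↦ singularCohomology.map ℤ ℤ (torusConcat k l m h) 1 (torusXi ℤ (m + 1) i)) ∘
      fun i : Fin (k + 1) ↦ id (Fin.cast h (Fin.castAdd (l + 1) i))) =
      fun i ↦ singularCohomology.map ℤ ℤ (ContinuousMap.fst : C(Torus (k + 1) × Torus (l + 1), Torus (k + 1))) 1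
        (torusXi ℤ (k + 1) i) := by
    funext i
    have hi : ((Fin.cast h (Fin.castAdd (l + 1) i) : Fin (m + 1)) : ℕ) < k + 1 := i.2
    have hi' : (⟨((Fin.cast h (Fin.castAdd (l + 1) i) : Fin (m + 1)) : ℕ), hi⟩ : Fin (k + 1)) = i := Fin.ext rfl
    rw [Function.comp_apply, id, map_torusConcat_torusXi_of_lt h _ hi, hi']
  have h₂ : ((fun i ↦ singularCohomology.map ℤ ℤ (torusConcat k l m h) 1 (torusXi ℤ (m + 1) i)) ∘
      fun j : Fin (l + 1) ↦ id (Fin.cast h (Fin.natAdd (k + 1) j))) =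
      fun j ↦ singularCohomology.map ℤ ℤ (ContinuousMap.snd : C(Torus (k + 1) × Torus (l + 1), Torus (l + 1))) 1
        (torusXi ℤ (l + 1) j) := by
    funext j
    have hj : k + 1 ≤ ((Fin.cast h (Fin.natAdd (k + 1) j) : Fin (m + 1)) : ℕ) := Nat.le_add_right _ _
    have hj' : (⟨((Fin.cast h (Fin.natAdd (k + 1) j) : Fin (m + 1)) : ℕ) - (k + 1), by omega⟩ : Fin (l + 1)) = j :=
      Fin.ext (Nat.add_sub_cancel_left _ _)
    rw [Function.comp_apply, id, map_torusConcat_torusXi_of_le h _ hj, hj']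
  rw [← h₁, ← h₂, cupMonomial_comp, cupMonomial_comp]
  rfl

/-- **Concatenation carries the cross product of the top monomials to the top monomial**:
`concat_* ((λ₀ ⋆ ⋯ ⋆ λₖ) × (λ₀ ⋆ ⋯ ⋆ λₗ)) = λ₀ ⋆ ⋯ ⋆ λₘ` in the rank-one `Hₘ₊₁(Tᵐ⁺¹; ℤ)`, `m = k + l + 1`
— both sides pair to `1` with the top cup monomial (`⟨pr₁^* top ⌣ pr₂^* top, top × top⟩ = 1 · 1`).
[cite: Lange2023AbelianVarietiesComplex, §2.5.3 Lemma 2.5.12 (proof, held p0133)] -/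
theorem map_torusConcat_cross_topMonomial (h : k + 1 + (l + 1) = m + 1) :
    singularHomology.map ℤ ℤ (torusConcat k l m h) (m + 1)
        (cross ℤ (Torus (k + 1)) (Torus (l + 1)) h (topMonomial k) (topMonomial l)) =
      topMonomial m := by
  classical
  refine (monomialEval_bijective (n := m + 1) (k := m)).1 (funext fun t ↦ ?_)
  rw [monomialEval, LinearMap.pi_apply, LinearMap.pi_apply]
  have ht : torusMonomial ℤ (m + 1) (m + 1) (subsetEmb t) = torusTop ℤ (m + 1) := by
    rw [subsetEmb_eq_id]; rfl
  rw [ht, ← kroneckerPairing_map, map_torusConcat_torusTop h,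
    kroneckerPairing_cupProduct_cross_of_hasNormalizedRep h (hasNormalizedRep_torusTop _) (hasNormalizedRep_torusTop _)]
  change kroneckerPairing ℤ ℤ (Torus (k + 1)) (k + 1) (torusTop ℤ (k + 1)) (topMonomial k) *
      kroneckerPairing ℤ ℤ (Torus (l + 1)) (l + 1) (torusTop ℤ (l + 1)) (topMonomial l) =
    kroneckerPairing ℤ ℤ (Torus (m + 1)) (m + 1) (torusTop ℤ (m + 1)) (topMonomial m)
  rw [kroneckerPairing_torusTop_topMonomial k, kroneckerPairing_torusTop_topMonomial l,
    kroneckerPairing_torusTop_topMonomial m, mul_one]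

/-- **The Pontryagin product of monomials is the monomial of the concatenated word**:
`(λ_{e 0} ⋆ ⋯ ⋆ λ_{e k}) ⋆ (λ_{e' 0} ⋆ ⋯ ⋆ λ_{e' l}) = λ_{e 0} ⋆ ⋯ ⋆ λ_{e k} ⋆ λ_{e' 0} ⋆ ⋯ ⋆ λ_{e' l}`
(Lange writes `λ_I = λ_{i₁} ⋆ ⋯ ⋆ λ_{i_p}` without brackets, §2.5.3; Exercise 1.1.6 (11)(b)(ii)).
[cite: Lange2023AbelianVarietiesComplex, Exercise 1.1.6 (11)(b)(ii) (held p0028); §2.5.3 (held p0133 L15–L17)] -/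
theorem addPontryagin_pontryaginMonomial (h : k + 1 + (l + 1) = m + 1) (e : Fin (k + 1) → Fin n)
    (e' : Fin (l + 1) → Fin n) :
    addPontryagin ℤ (Torus n) h (pontryaginMonomial n k e) (pontryaginMonomial n l e') =
      pontryaginMonomial n m (appendWord e e' m h) := by
  rw [pontryaginMonomial_eq_map_torusWordHom e, pontryaginMonomial_eq_map_torusWordHom e', addPontryagin_apply,
    ← map_prodMap_cross, ← ModuleCat.comp_apply, ← singularHomology.map_comp, addMap_comp_prodMap_torusWordHom e e' h,
    singularHomology.map_comp, ModuleCat.comp_apply, map_torusConcat_cross_topMonomial h,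
    ← pontryaginMonomial_eq_map_torusWordHom]

end Concat

/-! ### Associativity -/

section Assoc

variable {n : ℕ}

/-- Concatenation of words is associative. [cite: Lange2023AbelianVarietiesComplex, Exercise 1.1.6 (11)(b)(ii) (held p0028)] -/
theorem appendWord_assoc {a b c m s t : ℕ} (h₁ : a + 1 + (b + 1) = m + 1) (h₂ : m + 1 + (c + 1) = s + 1)
    (h₃ : b + 1 + (c + 1) = t + 1) (h₄ : a + 1 + (t + 1) = s + 1) (e₁ : Fin (a + 1) → Fin n)
    (e₂ : Fin (b + 1) → Fin n) (e₃ : Fin (c + 1) → Fin n) :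
    appendWord (appendWord e₁ e₂ m h₁) e₃ s h₂ = appendWord e₁ (appendWord e₂ e₃ t h₃) s h₄ := by
  funext i
  by_cases hi₁ : (i : ℕ) < a + 1
  · rw [appendWord_apply_of_lt _ _ h₂ i (show (i : ℕ) < m + 1 by omega), appendWord_apply_of_lt _ _ h₁ _ hi₁,
      appendWord_apply_of_lt _ _ h₄ i hi₁]
  · by_cases hi₂ : (i : ℕ) < m + 1
    · rw [appendWord_apply_of_lt _ _ h₂ i hi₂, appendWord_apply_of_le _ _ h₁ _ (Nat.not_lt.mp hi₁),
        appendWord_apply_of_le _ _ h₄ i (Nat.not_lt.mp hi₁),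
        appendWord_apply_of_lt _ _ h₃ _ (show (i : ℕ) - (a + 1) < b + 1 by omega)]
    · rw [appendWord_apply_of_le _ _ h₂ i (Nat.not_lt.mp hi₂), appendWord_apply_of_le _ _ h₄ i (Nat.not_lt.mp hi₁),
        appendWord_apply_of_le _ _ h₃ _ (show b + 1 ≤ (i : ℕ) - (a + 1) by omega)]
      congr 1
      exact Fin.ext (by simp only; omega)

/-- **Expansion in the monomial basis with integer multiples**: `x = ∑_s ⟨ξ_s, x⟩ · λ_s` (the sum written
with the group multiples `ℤ • Hₖ₊₁`). [cite: Lange2023AbelianVarietiesComplex, §2.5.3 Lemma 2.5.12 (held p0133 L19–L23)] -/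
theorem eq_sum_zsmul_pontryaginMonomial {k : ℕ} (x : singularHomology ℤ ℤ (Torus n) (k + 1)) :
    x = ∑ s, ((pontryaginMonomialBasis n k).repr x s) • pontryaginMonomial n k (subsetEmb s) := by
  conv_lhs => rw [← (pontryaginMonomialBasis n k).sum_repr x]
  refine Finset.sum_congr rfl fun s _ ↦ ?_
  rw [pontryaginMonomialBasis_apply]
  exact int_smul_eq_zsmul _ _ _

/-- `⋆` commutes with integer multiples on the left (bilinearity). [cite: Lange2023AbelianVarietiesComplex, Exercise 1.1.6 (11)(a) (held p0028)] -/
theorem addPontryagin_zsmul_left {p q r : ℕ} (hpq : p + q = r) (c : ℤ) (u : singularHomology ℤ ℤ (Torus n) p)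
    (v : singularHomology ℤ ℤ (Torus n) q) :
    addPontryagin ℤ (Torus n) hpq (c • u) v = c • addPontryagin ℤ (Torus n) hpq u v :=
  map_zsmul (AddMonoidHom.mk' (fun u : singularHomology ℤ ℤ (Torus n) p ↦ addPontryagin ℤ (Torus n) hpq u v)
    fun a b ↦ by rw [map_add, LinearMap.add_apply]) c u

/-- `⋆` commutes with integer multiples on the right (bilinearity). [cite: Lange2023AbelianVarietiesComplex, Exercise 1.1.6 (11)(a) (held p0028)] -/
theorem addPontryagin_zsmul_right {p q r : ℕ} (hpq : p + q = r) (c : ℤ) (u : singularHomology ℤ ℤ (Torus n) p)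
    (v : singularHomology ℤ ℤ (Torus n) q) :
    addPontryagin ℤ (Torus n) hpq u (c • v) = c • addPontryagin ℤ (Torus n) hpq u v :=
  map_zsmul (AddMonoidHom.mk' (fun v : singularHomology ℤ ℤ (Torus n) q ↦ addPontryagin ℤ (Torus n) hpq u v)
    fun a b ↦ by rw [map_add]) c v

/-- `⋆` commutes with sums on the left (bilinearity). [cite: Lange2023AbelianVarietiesComplex, Exercise 1.1.6 (11)(a) (held p0028)] -/
theorem addPontryagin_sum_left {p q r : ℕ} (hpq : p + q = r) {ι : Type*} (t : Finset ι)
    (g : ι → singularHomology ℤ ℤ (Torus n) p) (v : singularHomology ℤ ℤ (Torus n) q) :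
    addPontryagin ℤ (Torus n) hpq (∑ i ∈ t, g i) v = ∑ i ∈ t, addPontryagin ℤ (Torus n) hpq (g i) v := by
  rw [map_sum, LinearMap.sum_apply]

/-- **Associativity of the Pontryagin product** on `H_{≥1}((ℝ/ℤ)ⁿ; ℤ)`: `(x ⋆ y) ⋆ z = x ⋆ (y ⋆ z)` for
`x ∈ Hₐ₊₁`, `y ∈ H_{b+1}`, `z ∈ H_{c+1}` (any degree bookkeeping `h₁, …, h₄`) — Lange 2023,
Exercise 1.1.6 (11)(b)(ii) "`([σ] ⋆ [τ]) ⋆ [λ] = [σ] ⋆ ([τ] ⋆ [λ])`", here for the torus: both sides are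
additive in each variable and agree on the Pontryagin-monomial bases by `addPontryagin_pontryaginMonomial`.
[cite: Lange2023AbelianVarietiesComplex, Exercise 1.1.6 (11)(b)(ii) (held p0028)] -/
theorem addPontryagin_assoc {a b c m s t : ℕ} (h₁ : a + 1 + (b + 1) = m + 1) (h₂ : m + 1 + (c + 1) = s + 1)
    (h₃ : b + 1 + (c + 1) = t + 1) (h₄ : a + 1 + (t + 1) = s + 1) (x : singularHomology ℤ ℤ (Torus n) (a + 1))
    (y : singularHomology ℤ ℤ (Torus n) (b + 1)) (z : singularHomology ℤ ℤ (Torus n) (c + 1)) :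
    addPontryagin ℤ (Torus n) h₂ (addPontryagin ℤ (Torus n) h₁ x y) z =
      addPontryagin ℤ (Torus n) h₄ x (addPontryagin ℤ (Torus n) h₃ y z) := by
  have key₃ : ∀ (e₁ : Fin (a + 1) → Fin n) (e₂ : Fin (b + 1) → Fin n) (e₃ : Fin (c + 1) → Fin n),
      addPontryagin ℤ (Torus n) h₂ (addPontryagin ℤ (Torus n) h₁ (pontryaginMonomial n a e₁) (pontryaginMonomial n b e₂))
          (pontryaginMonomial n c e₃) =
        addPontryagin ℤ (Torus n) h₄ (pontryaginMonomial n a e₁)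
          (addPontryagin ℤ (Torus n) h₃ (pontryaginMonomial n b e₂) (pontryaginMonomial n c e₃)) := by
    intro e₁ e₂ e₃
    rw [addPontryagin_pontryaginMonomial h₁, addPontryagin_pontryaginMonomial h₂, addPontryagin_pontryaginMonomial h₃,
      addPontryagin_pontryaginMonomial h₄, appendWord_assoc]
  have key₂ : ∀ (e₁ : Fin (a + 1) → Fin n) (e₂ : Fin (b + 1) → Fin n) (z : singularHomology ℤ ℤ (Torus n) (c + 1)),
      addPontryagin ℤ (Torus n) h₂ (addPontryagin ℤ (Torus n) h₁ (pontryaginMonomial n a e₁) (pontryaginMonomial n b e₂)) z =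
        addPontryagin ℤ (Torus n) h₄ (pontryaginMonomial n a e₁)
          (addPontryagin ℤ (Torus n) h₃ (pontryaginMonomial n b e₂) z) := by
    intro e₁ e₂ z
    rw [eq_sum_zsmul_pontryaginMonomial z]
    simp only [map_sum, addPontryagin_zsmul_right, key₃]
  have key₁ : ∀ (e₁ : Fin (a + 1) → Fin n) (y : singularHomology ℤ ℤ (Torus n) (b + 1)),
      addPontryagin ℤ (Torus n) h₂ (addPontryagin ℤ (Torus n) h₁ (pontryaginMonomial n a e₁) y) z =
        addPontryagin ℤ (Torus n) h₄ (pontryaginMonomial n a e₁) (addPontryagin ℤ (Torus n) h₃ y z) := by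
    intro e₁ y
    rw [eq_sum_zsmul_pontryaginMonomial y]
    simp only [map_sum, LinearMap.sum_apply, addPontryagin_zsmul_left, addPontryagin_zsmul_right, key₂]
  rw [eq_sum_zsmul_pontryaginMonomial x]
  simp only [map_sum, LinearMap.sum_apply, addPontryagin_zsmul_left, key₁]

end Assoc

/-! ### Monomials with a repeated circle vanish -/

section Vanishing

variable {n d : ℕ}

/-- `H_{d+1}((ℝ/ℤ)ᵈ; ℤ) = 0` (rank `C(d, d+1) = 0`). [cite: HatcherAT2002, §3.2 Example 3.16] -/
theorem subsingleton_singularHomology_torus_succ (d : ℕ) :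
    Subsingleton (singularHomology ℤ ℤ (Torus d) (d + 1)) := by
  obtain ⟨e⟩ := nonempty_singularHomology_torus_equiv (R := ℤ) (M := ℤ) d (d + 1)
  rw [Nat.choose_succ_self] at e
  exact e.toEquiv.subsingleton

/-- A word with a repeated letter factors through a word on `d` letters:
`w = (w ∘ j.succAbove) ∘ c` with `c` collapsing `j` onto the position of `i` (`w i = w j`, `i ≠ j`).
[cite: Lange2023AbelianVarietiesComplex, Exercise 1.1.6 (11)–(12) (held p0028)] -/
theorem exists_comp_eq_of_apply_eq {w : Fin (d + 1) → Fin n} {i j : Fin (d + 1)} (hij : i ≠ j) (hw : w i = w j) :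
    ∃ c : Fin (d + 1) → Fin d, w = (w ∘ j.succAbove) ∘ c := by
  obtain ⟨i', hi'⟩ := Fin.exists_succAbove_eq hij
  classical
  refine ⟨fun x ↦ if hx : x = j then i' else (Fin.exists_succAbove_eq hx).choose, funext fun x ↦ ?_⟩
  by_cases hx : x = j
  · subst hx
    show w x = w (x.succAbove (dite (x = x) (fun _ ↦ i') _))
    rw [dif_pos rfl, hi']
    exact hw.symm
  · show w x = w (j.succAbove (dite (x = j) (fun _ ↦ i') _))
    rw [dif_neg hx, (Fin.exists_succAbove_eq hx).choose_spec]

/-- **A Pontryagin monomial with a repeated circle vanishes**: `λ_{w 0} ⋆ ⋯ ⋆ λ_{w d} = 0` if `w i = w j`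
for some `i ≠ j` — its word homomorphism factors through `Tᵈ`, and `H_{d+1}(Tᵈ; ℤ) = 0`. In the
exterior algebra `H_•(X, ℤ) = ⋀^• H₁` this is `λ ∧ λ = 0`. [cite: Lange2023AbelianVarietiesComplex, Exercise 1.1.6 (11)–(12) (held p0028)] -/
theorem pontryaginMonomial_eq_zero_of_not_injective {w : Fin (d + 1) → Fin n} (hw : ¬Function.Injective w) :
    pontryaginMonomial n d w = 0 := by
  obtain ⟨i, j, hwij, hij⟩ : ∃ i j, w i = w j ∧ i ≠ j := by
    simpa [Function.Injective] using hw
  obtain ⟨c, hc⟩ := exists_comp_eq_of_apply_eq hij hwij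
  rw [pontryaginMonomial_eq_map_torusWordHom, hc, ← torusWordHom_comp, singularHomology.map_comp, ModuleCat.comp_apply,
    (subsingleton_singularHomology_torus_succ d).elim (singularHomology.map ℤ ℤ (torusWordHom c) (d + 1) (topMonomial d)) 0,
    map_zero]

/-- **`λ_a ⋆ λ_a = 0`** in `H₂((ℝ/ℤ)ⁿ; ℤ)`. [cite: Lange2023AbelianVarietiesComplex, §2.5.3 Lemma 2.5.11 (held p0132–p0133)] -/
theorem addPontryagin_torusLambda_self (a : Fin n) :
    addPontryagin ℤ (Torus n) rfl (torusLambda n a) (torusLambda n a) = 0 := by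
  have h := pontryaginMonomial_eq_zero_of_not_injective (n := n) (d := 1) (w := fun _ ↦ a)
    fun hinj ↦ absurd (@hinj 0 1 rfl) (by decide)
  rw [pontryaginMonomial_succ, pontryaginMonomial_zero] at h
  exact h

end Vanishing

end Literature.AlgebraicTopology.SingularHomology

end
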